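import Literature.Probability.FitznerVanDerHofstad2017.Stage1CellsU
import Literature.Probability.FitznerVanDerHofstad2017.MeanFieldD11Stage1EvalRec
import HarnessLib

/-!
# FitznerVanDerHofstad2017.MeanFieldD11Stage1URecord — the derivable-multiplicity polygon cells at the certified `d = 11` record (kernel)

LANDING MODULE (b2b-lace, LEAN TYPING SEAT 2, gen 13; companion of `Stage1CellsU`, LEMMAS §21 node N72(b) tranche 1).
ADDITIVE: nothing in `Stage1Cells*`, `Stage1Eval*`, `MeanFieldD11Cert` (rev 6), `MeanFieldD11Inputs`, `NobleInstantiate`,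
`NobleAssumptions` is touched.

WHAT.  Kernel-decided (`decide +kernel` over the generic ℚ mirror `Stage1Cells.DataQ.ev` of `Stage1Eval`) facts about the
`Stage1Cells.Rec.U` polygon cells at the certified `d = 11` record data — tables `CertD11.dataHi`, parameters
`CertD11.P = ⟨11, 12, 28⟩` (`R = RSteps = 14`, `CS = 12`), the O12g state of record `CertD11Rec.stateRec`, both points
`s = i, o` — for EVERY polygon instance the Stage-1 table uses (`triangle (3,0), (3,1), (4,0), (4,1), (5,0)`;
`square (4,0), (4,1)`; `openTriangle (2,0), (3,0), (3,1), (4,0)`; `openSquare (3,0)` — all call sites of `Stage1Cells`):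
* `ev_triangle_rec`, `ev_square_rec`: each `U` closed cell equals its CODED namesake PLUS exactly `n = R − m` tail units
  (`(2dz)^{R−k} VarGamma2 I[1,R,{0}]` for the triangle, `n = 11, 11, 10, 10, 9`; `(2dz)^{R−k} VarGamma2² I[2,R,{0}]` for the
  square, `n = 10, 10`) — the identity `C(n+1,2) = C(n,2) + n` of LEMMAS §21 ('UNDER by n') realised at the record;
* `ev_open_rec`: each `U` open triangle / square evaluates to its K-branch `(2dz)^{m−k} VarGamma2^{3|4} K[3|4,m,{1}]`
  (the additive extraction branch with the derivable counts loses, cf. `Stage1OpenBranchD11`);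
* `ev_openTriangle_coded_vs_U_rec`: the coded open triangle is STRICTLY BELOW the `U` one at `m = 2, 3` (there the coded
  D12 product branch is the selected minimum) and EQUAL to it at `(4,0)`; the coded and `U` open squares `(3,0)` agree.

WHY.  These are the cell-level VALUE differences, at the record, between the typed recipe AS CODED (named in the (S2a′)
hypotheses of `D11.meanField_d11_typedStage1`) and the derivable-multiplicity class `U` (the class of the engines' runs of
record and of the cited numerals `D11.inputsI/O`): `+ n ·` one-tail unit per closed triangle, `+ n ·` two-tail unit per
closed square, the K-branch in place of the D12 product at the open triangles `m = 2, 3`, nothing else (GAPS 'lean2 gen 13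
— AMENDMENT 2').  Tranche 2 of N72(b) (the ℚ mirror `inpR…U` of the cell-44 record over `Rec.U`, the `N ≥ 4` tails over
`Rec.U.C3`, and the re-decided dominations against `D11.inputsO` / `D11.inputsI2`) builds on these cells.

EPISTEMIC STATUS.  Kernel facts about typed text at typed rational data (`#print axioms`: `propext`, `Classical.choice`,
`Quot.sound`); no bound on a lattice quantity is asserted.  No dimension sentence of the packet is touched (VERDICT-D10 NO;
`MeanFieldD11Cert` rev 6 is the record).

[cite: FitznerVanDerHofstad2016NoBLE, §5.3 (5.40)–(5.42) (PTRF 169 p. 1098): repulsive-polygon multiplicities]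
[cite: FitznerVanDerHofstad2017, notebook Percolation.nb cells 11–12 (transcript l.389–461)]
-/

namespace Literature.Probability.FitznerVanDerHofstad2017
namespace Stage1Cells
namespace Rec
namespace U

open NoGoFrame PX

/-! ## The `U` cells at the certified `d = 11` record: closed cells = coded + `n ·` tail unit, open cells = K-branch (kernel) -/

namespace CertD11Rec

open CertD11 (P dataHi)
open Stage1Cells.CertD11Rec (stateRec)

set_option maxHeartbeats 4000000 in
/-- at the record `(dataHi, P = ⟨11,12,28⟩, stateRec)` (`R = 14`), point `s`: every `U.triangle` instance the table uses
exceeds the coded `Stage1Cells.triangle` by exactly `n = R − m` one-tail units `(2dz)^{R−k} VarGamma2 I[1,R,{0}]`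
(`C(n+1,2) − C(n,2) = n`; `n = 11, 11, 10, 10, 9`). [folklore] -/
theorem ev_triangle_rec (s : Pt) :
    dataHi.ev P s stateRec (U.triangle P 3 0) =
      dataHi.ev P s stateRec (Stage1Cells.triangle P 3 0) + 11 * dataHi.ev P s stateRec (w P ^ (P.R - 0) * Vg * tab (.I 1 P.R .v0)) ∧
    dataHi.ev P s stateRec (U.triangle P 3 1) =
      dataHi.ev P s stateRec (Stage1Cells.triangle P 3 1) + 11 * dataHi.ev P s stateRec (w P ^ (P.R - 1) * Vg * tab (.I 1 P.R .v0)) ∧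
    dataHi.ev P s stateRec (U.triangle P 4 0) =
      dataHi.ev P s stateRec (Stage1Cells.triangle P 4 0) + 10 * dataHi.ev P s stateRec (w P ^ (P.R - 0) * Vg * tab (.I 1 P.R .v0)) ∧
    dataHi.ev P s stateRec (U.triangle P 4 1) =
      dataHi.ev P s stateRec (Stage1Cells.triangle P 4 1) + 10 * dataHi.ev P s stateRec (w P ^ (P.R - 1) * Vg * tab (.I 1 P.R .v0)) ∧
    dataHi.ev P s stateRec (U.triangle P 5 0) =
      dataHi.ev P s stateRec (Stage1Cells.triangle P 5 0) + 9 * dataHi.ev P s stateRec (w P ^ (P.R - 0) * Vg * tab (.I 1 P.R .v0)) := by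
  cases s <;> refine ⟨?_, ?_, ?_, ?_, ?_⟩ <;> decide +kernel

set_option maxHeartbeats 4000000 in
/-- at the record, point `s`: every `U.square` instance the table uses exceeds the coded `Stage1Cells.square` by exactly
`n = R − m = 10` two-tail units `(2dz)^{R−k} VarGamma2² I[2,R,{0}]`. [folklore] -/
theorem ev_square_rec (s : Pt) :
    dataHi.ev P s stateRec (U.square P 4 0) =
      dataHi.ev P s stateRec (Stage1Cells.square P 4 0) + 10 * dataHi.ev P s stateRec (w P ^ (P.R - 0) * Vg ^ 2 * tab (.I 2 P.R .v0)) ∧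
    dataHi.ev P s stateRec (U.square P 4 1) =
      dataHi.ev P s stateRec (Stage1Cells.square P 4 1) + 10 * dataHi.ev P s stateRec (w P ^ (P.R - 1) * Vg ^ 2 * tab (.I 2 P.R .v0)) := by
  cases s <;> refine ⟨?_, ?_⟩ <;> decide +kernel

set_option maxHeartbeats 4000000 in
/-- at the record, point `s`: every `U.openTriangle` / `U.openSquare` instance the table uses evaluates to its K-branch
`(2dz)^{m−k} VarGamma2³ K[3,m,{1}]` / `(2dz)^{m−k} VarGamma2⁴ K[4,m,{1}]` (the additive extraction branch loses). [folklore] -/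
theorem ev_open_rec (s : Pt) :
    dataHi.ev P s stateRec (U.openTriangle P 2 0) = dataHi.ev P s stateRec (w P ^ (2 - 0) * Vg ^ 3 * tab (.K 3 2 .v1)) ∧
    dataHi.ev P s stateRec (U.openTriangle P 3 0) = dataHi.ev P s stateRec (w P ^ (3 - 0) * Vg ^ 3 * tab (.K 3 3 .v1)) ∧
    dataHi.ev P s stateRec (U.openTriangle P 3 1) = dataHi.ev P s stateRec (w P ^ (3 - 1) * Vg ^ 3 * tab (.K 3 3 .v1)) ∧
    dataHi.ev P s stateRec (U.openTriangle P 4 0) = dataHi.ev P s stateRec (w P ^ (4 - 0) * Vg ^ 3 * tab (.K 3 4 .v1)) ∧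
    dataHi.ev P s stateRec (U.openSquare P 3 0) = dataHi.ev P s stateRec (w P ^ (3 - 0) * Vg ^ 4 * tab (.K 4 3 .v1)) := by
  cases s <;> refine ⟨?_, ?_, ?_, ?_, ?_⟩ <;> decide +kernel

set_option maxHeartbeats 4000000 in
/-- at the record, point `s`: the coded open triangle is STRICTLY BELOW the `U` open triangle at `m = 2, 3` and equal to it
at `(4,0)`; the coded and `U` open squares `(3,0)` agree (cf. `Stage1OpenBranchD11`). [folklore] -/
theorem ev_openTriangle_coded_vs_U_rec (s : Pt) :
    dataHi.ev P s stateRec (Stage1Cells.openTriangle P 2 0) < dataHi.ev P s stateRec (U.openTriangle P 2 0) ∧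
    dataHi.ev P s stateRec (Stage1Cells.openTriangle P 3 0) < dataHi.ev P s stateRec (U.openTriangle P 3 0) ∧
    dataHi.ev P s stateRec (Stage1Cells.openTriangle P 3 1) < dataHi.ev P s stateRec (U.openTriangle P 3 1) ∧
    dataHi.ev P s stateRec (Stage1Cells.openTriangle P 4 0) = dataHi.ev P s stateRec (U.openTriangle P 4 0) ∧
    dataHi.ev P s stateRec (Stage1Cells.openSquare P 3 0) = dataHi.ev P s stateRec (U.openSquare P 3 0) := by
  cases s <;> refine ⟨?_, ?_, ?_, ?_, ?_⟩ <;> decide +kernel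

end CertD11Rec

end U
end Rec
end Stage1Cells
end Literature.Probability.FitznerVanDerHofstad2017
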